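import Summits.Ventures.CertifiedManyBodySolver.Observables.StiffnessKinematicLeaf
import Literature.MathematicalPhysics.QuantumLattice.HubbardTTPrimeCapCutDualRows
import HarnessLib

/-!
# Ventures/CertifiedManyBodySolver — Observables/StiffnessChordLeaf.lean

HONEST FRAMING: one-sided certified CEILINGS on the kinetic energy and on the uniform flux stiffness from TWO certified ENERGY rows at two
couplings on the same `(n, t′ = 0)` ray (zero observable compute); not stiffness floors; kinematic/energetics scale; not informative vs print;
not a superconductivity verdict. No definition, no claim node, no `sorry`.

Cell `hubbard-obs` (D-0042), seat p2 (stiffness), `prover-hubbard-obs-p2-g10-0`. The ANCHOR-GENERIC form of the cell's zero-compute stiffness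
ceiling of record (registry rows 5–6, `m3_tp0_fluxStiffness_le_chordSharp_r354_r426`: `ρ_s(8, 7/8, 0) ≤ 0.3748013` from #354 ∧ #426 — there by
pub-hubbard's finite-torus `Bounds.stiffness_le_of_energyDensityBrackets_sharp`, all-even-sides form). Here in the thermodynamic-limit language of
the anchor leaves (`Observables/RungLeavesStiffnessAnchor.lean`), for ANY `0 ≤ U₁ < U`, `0 ≤ n < 2`, so that every pair of burst anchors on a
`(n, 0)` ray (A7–A1, A6–A1, A7–A6, …) and every control pair gets its chord row by ONE line — the «chord» discharger missing from p440587's list: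

* `torusLimit_negKinetic_le_uchord` — cap `e(1,0,U,n) ≤ hi` and floor `lo₁ ≤ e(1,0,U₁,n)` ⇒ for every torus limit `ω` of unit
  `(rectN n L, S^z = 0)`-sector ground states of `hubbardTorusTT' L 1 0 U`: `−k(ω) ≤ (U₁·hi − U·lo₁)/(U − U₁)` — the SHARP chord
  (`−k = U·D − e₀`, `torusLimit_kineticDensity_eq_energy_sub_docc`; `(U − U₁)·D ≤ e₀ − e(U₁) ≤ e₀ − lo₁` by hubbard-fast's upper `U`-chord
  `IsTorusLimitOf.re_expect_docc_le_chord_of_groundState` taken with the cap `u := e₀` itself; then `e₀ ≤ hi` enters with the nonnegative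
  coefficient `U₁/(U − U₁)`);
* `ObsStiffnessSeqCeilingAt_tp0_of_uchord` — hence the robust leaf `ObsStiffnessSeqCeilingAt 0 U n c` for every `c ≥ (U₁·hi − U·lo₁)/(4(U − U₁))`
  (f-sum, `ObsStiffnessSeqCeilingAt_tp0_of_kineticDensity_ge`), and the all-even-sides form.
Instances: the (8, 1, 0) CONTROL in `Certificates/HubbardSquare_n1_U8_stiffness_control.lean` (#472 ∧ #488: `ρ_s(8, 1, 0) ≤ 0.3132401`); the M3
literal `0.3748013` of rows 5–6 is reproduced by `(4·hi₃₅₄ − 8·lo₄₂₆)/16` (not re-stated here — landed).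

References: T. Koma, H. Tasaki, J. Stat. Phys. 76 (1994) 745, §1 [KomaTasaki1994]; T. Hazra, N. Verma, M. Randeria, PRX 9 (2019) 031049, eqs. (2)–(4)
[HazraVermaRanderia2019]; D. J. Scalapino, S. R. White, S.-C. Zhang, PRB 47 (1993) 7995, §II [ScalapinoWhiteZhang1993].
-/

noncomputable section

namespace Summit.Ventures.CertifiedManyBodySolver.Observables

open Literature.MathematicalPhysics.QuantumLattice
open Literature.MathematicalPhysics.QuantumLattice.ThermodynamicLimit
open Literature.Probability.LatticeModels
open Matrix Finset Filter Topology HubbardWave0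
open scoped Matrix BigOperators ComplexOrder

/-- **The sharp `U`-chord kinetic CEILING, anchor-generic** (`0 ≤ U₁ < U`, `0 ≤ n < 2`, `t′ = 0`): a certified cap `e(1,0,U,n) ≤ hi` and a
certified floor `lo₁ ≤ e(1,0,U₁,n)` give `−k(ω) ≤ (U₁·hi − U·lo₁)/(U − U₁)` for every torus limit `ω` of unit `(rectN n L, S^z = 0)`-sector
ground states of `hubbardTorusTT' L 1 0 U` (bond form). [cite: KomaTasaki1994, §1] [cite: HazraVermaRanderia2019, eq. (2)] -/
theorem torusLimit_negKinetic_le_uchord {U U₁ n : ℝ} (hU₁ : 0 ≤ U₁) (hlt : U₁ < U) (hn0 : 0 ≤ n) (hn2 : n < 2) {hi lo₁ : ℚ}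
    (hcap : energyDensityTT' 1 0 U n ≤ ((hi : ℚ) : ℝ)) (hfloor : ((lo₁ : ℚ) : ℝ) ≤ energyDensityTT' 1 0 U₁ n) :
    ∀ (ω : InfVolFermionState 2) (Ls : ℕ → ℕ) (ψ : ∀ L, Fock (Orb (FermionTorus 2 L))),
      Tendsto Ls atTop atTop →
      (∀ j, IsGroundStateInSector (hubbardTorusTT' (Ls j) 1 0 U) (rectN n (Ls j)) 0 (ψ (Ls j))) →
      (∀ j, star (ψ (Ls j)) ⬝ᵥ ψ (Ls j) = 1) → ω.IsTorusLimitOf ψ Ls →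
      -(∑ i : Fin 2, -(1 : ℝ) * ∑ σ : Fin 2,
          ((ω.expect {0, 0 + unitVec i}
              ((cAt 0 (mem_insert_self _ _) σ)ᴴ * cAt (0 + unitVec i) (mem_insert_of_mem (mem_singleton_self _)) σ)).re +
            (ω.expect {0, 0 + unitVec i}
              ((cAt (0 + unitVec i) (mem_insert_of_mem (mem_singleton_self _)) σ)ᴴ * cAt 0 (mem_insert_self _ _) σ)).re)) ≤
        (U₁ * ((hi : ℚ) : ℝ) - U * ((lo₁ : ℚ) : ℝ)) / (U - U₁) := by
  intro ω Ls ψ hLs hψ h1 hω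
  have hU : 0 ≤ U := hU₁.trans hlt.le
  have hd : 0 < U - U₁ := sub_pos.2 hlt
  rw [torusLimit_kineticDensity_eq_energy_sub_docc hU hn0 hn2 ω Ls ψ hLs hψ h1 hω]
  have hdocc : (ω.expect ({0} : Finset (Site 2)) (doccAt0 2)).re =
      (ω.expect {0} (nAt 0 (mem_singleton_self 0) 0 * nAt 0 (mem_singleton_self 0) 1)).re := rfl
  have hch := hω.re_expect_docc_le_chord_of_groundState 1 0 hU hn0 hn2 hLs hψ h1 (le_refl (energyDensityTT' 1 0 U n))
    hU₁ hlt hfloor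
  rw [← hdocc, le_div_iff₀ hd] at hch
  rw [le_div_iff₀ hd]
  have hU₁e : U₁ * energyDensityTT' 1 0 U n ≤ U₁ * ((hi : ℚ) : ℝ) := mul_le_mul_of_nonneg_left hcap hU₁
  nlinarith [hch, hU₁e, hU]

/-- **Robust stiffness leaf from the `U`-chord** (`t′ = 0`, `0 ≤ U₁ < U`, `0 ≤ n < 2`): cap at `U`, floor at `U₁` ⇒ `ObsStiffnessSeqCeilingAt 0 U n c` for every
rational `c ≥ (U₁·hi − U·lo₁)/(4(U − U₁))` (f-sum). [cite: ScalapinoWhiteZhang1993, §II] [cite: HazraVermaRanderia2019, eqs. (2)–(4)] -/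
theorem ObsStiffnessSeqCeilingAt_tp0_of_uchord {U U₁ n : ℝ} (hU₁ : 0 ≤ U₁) (hlt : U₁ < U) (hn0 : 0 ≤ n) (hn2 : n < 2) {hi lo₁ : ℚ}
    (hcap : energyDensityTT' 1 0 U n ≤ ((hi : ℚ) : ℝ)) (hfloor : ((lo₁ : ℚ) : ℝ) ≤ energyDensityTT' 1 0 U₁ n) (c : ℚ)
    (hc : (U₁ * ((hi : ℚ) : ℝ) - U * ((lo₁ : ℚ) : ℝ)) / (U - U₁) / 4 ≤ ((c : ℚ) : ℝ)) :
    ObsStiffnessSeqCeilingAt 0 U n c := by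
  refine ObsStiffnessSeqCeilingAt_tp0_of_kineticDensity_ge hn2.le (-((U₁ * ((hi : ℚ) : ℝ) - U * ((lo₁ : ℚ) : ℝ)) / (U - U₁))) c
    (by rw [neg_neg]; exact hc) fun ω Ls ψ hLs hψ h1 hω => ?_
  have h := torusLimit_negKinetic_le_uchord hU₁ hlt hn0 hn2 hcap hfloor ω Ls ψ hLs hψ h1 hω
  linarith

/-- The all-even-sides form. [cite: ScalapinoWhiteZhang1993, §II] -/
theorem ObsStiffnessCeilingAt_tp0_of_uchord {U U₁ n : ℝ} (hU₁ : 0 ≤ U₁) (hlt : U₁ < U) (hn0 : 0 ≤ n) (hn2 : n < 2) {hi lo₁ : ℚ}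
    (hcap : energyDensityTT' 1 0 U n ≤ ((hi : ℚ) : ℝ)) (hfloor : ((lo₁ : ℚ) : ℝ) ≤ energyDensityTT' 1 0 U₁ n) (c : ℚ)
    (hc : (U₁ * ((hi : ℚ) : ℝ) - U * ((lo₁ : ℚ) : ℝ)) / (U - U₁) / 4 ≤ ((c : ℚ) : ℝ)) :
    ObsStiffnessCeilingAt 0 U n c :=
  (ObsStiffnessSeqCeilingAt_tp0_of_uchord hU₁ hlt hn0 hn2 hcap hfloor c hc).ceilingAt

end Summit.Ventures.CertifiedManyBodySolver.Observables

end
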